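import Literature.MathematicalPhysics.QuantumManyBody.GroundStateFeynmanKacCutLine

/-!
# Sketch (crux-ideate, ideator 1, round 1) — crux `TwoReplicaTransienceBound`
(stmt-AtomisticToContinuum-9687, route BECCutLineWeakDisorder)

First-lemma signatures of the idea cards filed by this seat.  Nothing here is proved: every
`stub_*` is a `sorry`; the point is that the statements ELABORATE over the tree's vocabulary
(`GroundStateFeynmanKac*.lean`: `wienerPaths`, `worldLine`, `survives`, `expNeg`, `fkWeight`,
`fkPartition`, `fkSemigroup`, `IsGroundStateFK`).

* Card `tracer-decoupling`: `wienerLine`, `taggedBathAction`, `tracer`, `stub_fkPartition_vecCons`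
  (factorisation of the `(n+1)`-line partition function through the passive tracer functional) and
  `stub_tracerDecoupling` (Jensen over the tagged-free bath path law: the `x`-variance of the
  half-line partition function is at most the bath-averaged `x`-variance of the tracer functional).
* Card `static-response-recoil`: `stub_khasminskii` (gauge bound for a time-local nonnegative
  replica potential along the relative motion of two independent world-lines) and
  `stub_corrTime_le_response` (T = 0 fluctuation–dissipation in FK form: the time integral of the
  connected imaginary-time autocorrelation of a bounded observable under the FK ground state is
  bounded by the quadratic ENERGY response constant).
* Card `monotone-heat-flow-landscape`: `landscapeRatio` and `stub_landscapeRatio_mono`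
  (conjectural monotonicity in `T` of the crux's functional along `Ψ_T = e^{-TH}1/‖·‖`), plus
  `stub_landscapeRatio_zero` (its value `1` at `T = 0`, the trivially checkable end).
-/

noncomputable section

open MeasureTheory Filter Set
open scoped ENNReal NNReal Topology BigOperators

namespace Summit.AtomisticToContinuum.BoseEinsteinCondensation.Cruxes.TwoReplicaTransienceBound.SketchIdeator1

open Literature.MathematicalPhysics.QuantumManyBody.BoseGas
open Literature.Probability.Process (preWienerMeasure brownian)

variable {n : ℕ}

/-! ## Card `tracer-decoupling` -/

/-- Law of the three Brownian coordinates of ONE world-line (so that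
`wienerPaths (n+1) ≅ wienerLine ⊗ wienerPaths n` under `Fin.cons`). -/
def wienerLine : Measure (Fin 3 → (ℝ≥0 → ℝ)) :=
  Measure.pi fun _ : Fin 3 => preWienerMeasure

/-- The tagged–bath interaction action `∫₀ᵀ ∑ⱼ v(|B⁰_s - Bʲ_s|) ds` along tagged Brownian
coordinates `ω₀` and FROZEN bath paths `ωb` (bath lines started at `Y`, tagged line at `x`). -/
def taggedBathAction (v : ℝ → ℝ≥0∞) (T : ℝ) (x : Space) (Y : Config n)
    (ω₀ : Fin 3 → (ℝ≥0 → ℝ)) (ωb : PathSpace n) : ℝ≥0∞ :=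
  ∫⁻ s in Set.Ioc (0 : ℝ) T, ∑ j : Fin n,
    v (dist (worldLine (Matrix.vecCons x Y) (Fin.cons ω₀ ωb) s.toNNReal 0)
      (worldLine (Matrix.vecCons x Y) (Fin.cons ω₀ ωb) s.toNNReal j.succ))

/-- The PASSIVE-TRACER survival functional `g(x, ωb) = E_x[𝟙{B⁰ stays in Λ_L on [0,T]} ·
exp(-∫₀ᵀ ∑ⱼ v(|B⁰_s - Bʲ_s|) ds)]`: one Brownian line from `x` among the frozen bath
trajectories `ωb`; the bath does not react. -/
def tracer (v : ℝ → ℝ≥0∞) (L T : ℝ) (x : Space) (Y : Config n) (ωb : PathSpace n) : ℝ≥0∞ :=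
  ∫⁻ ω₀, (survives (N := 1) L T (fun _ => x)).indicator (fun _ => (1 : ℝ≥0∞)) (fun _ => ω₀) *
      expNeg (taggedBathAction v T x Y ω₀ ωb) ∂wienerLine

/-- FACTORISATION (first lemma, part a): the `(n+1)`-line partition function from the slice
`(x, Y)` is the bath-only FK weight integrated against the tracer functional:
`Z_T(x,Y) = ∫ w_bath(Y, ωb) · g(x, ωb) dW_n(ωb)` (`expNeg_add`, `interaction (x::Y) =
interaction Y + ∑ⱼ v(|x - yⱼ|)`, Tonelli, `wienerPaths (n+1) = map Fin.cons (wienerLine ⊗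
wienerPaths n)`). -/
theorem stub_fkPartition_vecCons {v : ℝ → ℝ≥0∞} (hv : Measurable v) (L : ℝ) {T : ℝ}
    (hT : 0 ≤ T) (x : Space) (Y : Config n) :
    fkPartition v L T (Matrix.vecCons x Y) =
      ∫⁻ ωb, fkWeight (N := n) v L T Y ωb * tracer v L T x Y ωb ∂wienerPaths n := by
  sorry

/-- TRACER DECOUPLING (first lemma, part b; subtraction-free form of
`L³∫ₓZ² - (∫ₓZ)² ≤ Z_bath(Y) · ∫ w_bath [L³∫ₓ g² - (∫ₓ g)²] dW_n`): Jensen for the convex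
functional `φ ↦ ‖φ - φ̄‖²_{L²(Λ)}` over the probability measure `w_bath dW_n / Z_bath(Y)`, which
does NOT depend on the tagged starting point `x`.  Consequence: the crux's integrand satisfies
`L³ m_T(Y)/s_T(Y)² - 1 = CV²ₓ(Z_T(·,Y)) ≤ E_{ωb ∼ bath}[Varₓ g]/ (E E_x g)²`, a second moment for
ONE Brownian directed polymer in the autonomous space-time trap field of the bath. -/
theorem stub_tracerDecoupling {v : ℝ → ℝ≥0∞} (hv : Measurable v) {L T : ℝ} (hL : 0 < L)
    (hT : 0 ≤ T) (Y : Config n) :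
    ENNReal.ofReal (L ^ 3) * (∫⁻ x, fkPartition v L T (Matrix.vecCons x Y) ^ 2) +
        fkPartition (N := n) v L T Y *
          ∫⁻ ωb, fkWeight (N := n) v L T Y ωb * (∫⁻ x, tracer v L T x Y ωb) ^ 2 ∂wienerPaths n ≤
      (∫⁻ x, fkPartition v L T (Matrix.vecCons x Y)) ^ 2 +
        fkPartition (N := n) v L T Y *
          (ENNReal.ofReal (L ^ 3) *
            ∫⁻ ωb, fkWeight (N := n) v L T Y ωb * (∫⁻ x, tracer v L T x Y ωb ^ 2) ∂wienerPaths n) := by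
  sorry

/-! ## Card `static-response-recoil` -/

/-- KHASMINSKII / GAUGE BOUND for the relative motion of two replicas (first lemma, part a):
two independent world-lines (`N = 2`, no interaction between them; relative start `y`) and a
time-local nonnegative replica potential `U` on `ℝ³` with Green-smallness
`E ∫₀ᵀ U(B⁰_s - B¹_s) ds ≤ α < 1` uniformly in the relative starting point; then the exponential
moment `E exp(+∫₀ᵀ U(B⁰_s - B¹_s) ds) ≤ 1/(1-α)` uniformly (expansion of the exponential in ordered
multiple integrals + Markov property; Chung–Zhao 1995, Lemma 3.7 "Khas'minskii's lemma").  In the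
line this is applied to the induced (bath-mediated, time-integrated) attraction between the past and
future half-lines, whose Green norm is `O(√(ρa³))`. -/
theorem stub_khasminskii (U : Space → ℝ≥0∞) (hU : Measurable U) {T : ℝ} (hT : 0 ≤ T) {α : ℝ≥0∞}
    (hα : α < 1)
    (hsmall : ∀ y : Space,
      ∫⁻ ω, (∫⁻ s in Set.Ioc (0 : ℝ) T,
        U (worldLine (N := 2) ![y, 0] ω s.toNNReal 0 - worldLine (N := 2) ![y, 0] ω s.toNNReal 1))
        ∂wienerPaths 2 ≤ α) (y : Space) :
    ∫⁻ ω, (expNeg (∫⁻ s in Set.Ioc (0 : ℝ) T,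
        U (worldLine (N := 2) ![y, 0] ω s.toNNReal 0 - worldLine (N := 2) ![y, 0] ω s.toNNReal 1)))⁻¹
      ∂wienerPaths 2 ≤ (1 - α)⁻¹ := by
  sorry

/-- T = 0 FLUCTUATION–DISSIPATION IN FK FORM (first lemma, part b; the dynamic → static hinge of the
transfer): for the FK ground state `Ψ₀` of the `n`-particle bath and a bounded measurable probe
`F ≥ 0` (e.g. `F(Y) = ∑ⱼ φ(yⱼ)`), IF the quadratic ENERGY-response bound
`E₀ - κ t² ≤ ⟨Ψ, H Ψ⟩ + t (⟨Ψ, F Ψ⟩ - ⟨F⟩₀)` holds for all real `t` and all finite-energy trial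
states (energy currency; the Dirichlet twin of `BECInsertionCorrector.StaticResponseBound`), THEN the
connected imaginary-time autocorrelation `C_F(τ) = e^{E₀τ}⟨FΨ₀, e^{-τH}(FΨ₀)⟩ - ⟨F⟩₀²` satisfies
`∫₀^S C_F(τ) dτ ≤ κ` for every `S ≥ 0` (second-order perturbation theory as a variational
inequality: trial states `Ψ_t ∝ (1 - t ∫₀^S e^{-τ(H-E₀)}(F-⟨F⟩₀) dτ) Ψ₀`, mollified into the `C¹`
core; the semigroup is `fkSemigroup`).  With `F` a density mode this is `m₋₁ = χ/2`: the time
integral that the two-replica coupling needs is a STATIC response. -/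
theorem stub_corrTime_le_response {v : ℝ → ℝ≥0∞} (hv : Measurable v) {L : ℝ} (hL : 0 < L)
    {Ψ₀ : Config n → ℝ} (hGS : IsGroundStateFK v L Ψ₀) (F : Config n → ℝ≥0∞) (hF : Measurable F)
    (hFb : ∀ Y, F Y ≤ 1) (κ : ℝ)
    (hresp : ∀ t : ℝ, ∀ Ψ : TrialState n L, energy v Ψ ≠ ⊤ →
      (groundStateEnergy v n L).toReal - κ * t ^ 2 ≤
        (energy v Ψ).toReal +
          t * ((∫ Y, (F Y).toReal * ‖Ψ.ψ Y‖ ^ 2) - ∫ Y, (F Y).toReal * Ψ₀ Y ^ 2))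
    (S : ℝ) (hS : 0 ≤ S) :
    ∫ τ in Set.Ioc (0 : ℝ) S,
        (Real.exp ((groundStateEnergy v n L).toReal * τ) *
            (∫⁻ Y, ENNReal.ofReal (Ψ₀ Y) * F Y *
              fkSemigroup v L τ (fun Y' => F Y' * ENNReal.ofReal (Ψ₀ Y')) Y).toReal -
          (∫ Y, (F Y).toReal * Ψ₀ Y ^ 2) ^ 2) ≤ κ := by
  sorry

/-! ## Card `monotone-heat-flow-landscape` -/

/-- The crux's functional at polymer half-length `T`: `R_T(v, L, n) = ∫ L³ m_T(Y)²/s_T(Y)² dY`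
for `Ψ_T = fkWitness v L T 1` on `n + 1` particles (verbatim the integrand of
`TwoReplicaTransienceBound`). -/
def landscapeRatio (v : ℝ → ℝ≥0∞) (L T : ℝ) (n : ℕ) : ℝ≥0∞ :=
  ∫⁻ Y : Config n, ENNReal.ofReal (L ^ 3) *
    (∫⁻ x, (‖fkWitness (N := n + 1) v L T (fun _ => (1 : ℝ≥0∞)) (Matrix.vecCons x Y)‖₊ : ℝ≥0∞) ^ 2) ^ 2 /
      (∫⁻ x, (‖fkWitness (N := n + 1) v L T (fun _ => (1 : ℝ≥0∞)) (Matrix.vecCons x Y)‖₊ : ℝ≥0∞)) ^ 2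

/-- The trivially checkable end: at `T = 0` the witness is the normalised indicator of the box, every
conditional profile is flat, and `R_0 = 1` (`fkSemigroup_zero`, `fkNormSq_zero`). -/
theorem stub_landscapeRatio_zero {v : ℝ → ℝ≥0∞} (hv : Measurable v) {L : ℝ} (hL : 0 < L) (n : ℕ) :
    landscapeRatio v L 0 n = 1 := by
  sorry

/-- CONJECTURAL MONOTONICITY (the lever of card `monotone-heat-flow-landscape`): along the heat flow
from the flat datum the landscape functional never decreases — `T ↦ R_T` is monotone on `[0, ∞)`
for every repulsive measurable `v` (free gas: `R_T = r(T/L²)³` with `r ↑ π²/8`, exact; toy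
numerics j015176 for `d = 1, 2`, `N ≤ 4`).  With `R_T → R(Ψ₀)` (`tendsto_fkWitness`) it transfers
the crux to the single ground-state bound `R(Ψ₀) ≤ C`. -/
theorem stub_landscapeRatio_mono {v : ℝ → ℝ≥0∞} (hv : IsRepulsiveFiniteRange v) {L : ℝ}
    (hL : 0 < L) (n : ℕ) : Monotone fun T : ℝ≥0 => landscapeRatio v L (T : ℝ) n := by
  sorry

end Summit.AtomisticToContinuum.BoseEinsteinCondensation.Cruxes.TwoReplicaTransienceBound.SketchIdeator1
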